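import Mathlib.LinearAlgebra.Span.Basic
import Mathlib.LinearAlgebra.Finsupp.LinearCombination
import Mathlib.Tactic.Abel
import HarnessLib

/-!
# Venture HSemireg — the window-stability criterion of the greedy SDR (kernel of LEMMAS A∕B of `WINDOWFREE-FHARM-w1cx2.md`)

Computation cell `pub-hsemireg`, squad W1, second-code seat w1-cx-2 (gen 12).

Setting on paper (NOT in this file). Code B of the cell evaluates transferred products in a
truncated Čech model `C_n(X)` of a line bundle `𝒪(X)` on an abelian surface; the truncation
«window» `n` grows, `C_ℓ ⊆ C_n` for `ℓ ≤ n`, and the strong deformation retract of each window is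
built by ONE greedy elimination in a fixed global order, which splits `C_n = K_n ⊕ B_n ⊕ H_n`
(`B_n` = coboundaries, `H_n` = span of the greedily selected cycle representatives, `K_n` = the
greedy complement of the cycles; the homotopy `h` is `(d|_{K})⁻¹` on `B` and `0` on `K ⊕ H`).
The note `widen/W1/WINDOWFREE-FHARM-w1cx2.md` proves that every value computed from cochains of
level `≤ ℓ` is the same at all windows `n ≥ ℓ` («window-free») from two lemmas whose
linear-algebra kernels are recorded here:

* `inf_le_of_pairing` (LEMMA B, the CERTIFICATE): if the window-`ℓ` cycles inside the big
  coboundary space, `B_n ⊓ C_ℓ`, lie in `B_ℓ ⊔ span {η_t}` (the window-`ℓ` cycle space), if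
  functionals `φ_s` vanish on `B_n`, and if the pairing matrix `(φ_s (η_t))` has trivial left
  kernel, then `B_n ⊓ C_ℓ ≤ B_ℓ` — no window-`ℓ` cycle becomes a coboundary in ANY larger window;
  `inf_eq_of_pairing` — the form `B_n ⊓ C_ℓ = B_ℓ` used in the note (hypothesis (N2));
* `decomposition_unique` and `preimage_unique` (LEMMA A (A3)): a vector has only one
  decomposition along three independent submodules `K, B, H`, and an injective-on-`K` map has
  only one `K`-preimage of a given value — so the window-`ℓ` decomposition of a window-`ℓ` cochain,
  which is also a window-`n` decomposition once `K_ℓ ≤ K_n`, `B_ℓ ≤ B_n`, `H_ℓ ≤ H_n`, IS the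
  window-`n` decomposition, and `p`, `h`, `i` restrict.

* `levelExact_iff` ∕ `levelExact_partition` ∕ `levelExact_partition'` ∕ `levelExact_regular_iff` (THEOREM W (a) of
  `widen/W1/WINDOW-EXACTNESS-w1cx2.md` §1, the certificate-free route): on the curve
  `y² = x³ − 1` with the cover `U₀ = {j ≥ 0}` (regular away from `o`), `U₁ = {2i + 3j ≤ a}` (pole
  order `≤ a` at `o`), a monomial `xⁱyʲ` (`0 ≤ i ≤ 2`) has window level `≤ L` iff
  `2i + 3j ≤ 3L ∧ −j ≤ L`; the monomials of level EXACTLY `L` are `y^{−L}, xy^{−L}, x²y^{−L}, y^L,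
  xy^{L−1}, x²y^{L−2}`, and for `L ≥ 2`, `−2 ≤ a ≤ 3` (resp. `L ≥ 3`, `|a| ≤ 4`) each of them lies in
  EXACTLY ONE of `U₀`, `U₁` — so the level-`L` graded piece of the truncated Čech complex
  `𝒪(U₀) ⊕ 𝒪(a·o)(U₁) → 𝒪(U₀₁)` is a bijection `K³ ⊕ K³ → K⁶`, i.e. acyclic, which by Künneth makes
  every window inclusion a quasi-isomorphism for the c-free divisors (pure linear integer
  arithmetic, `omega`).

On paper the functionals are `v ↦ Tr (v ∪ ψ_s)` for cocycles `ψ_s` of `𝒪(−X)` (Serre pairing),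
which vanish on all coboundaries by the Leibniz rule and `Tr ∘ d = 0`; the finite pairing matrices
are computed exactly in `ℚ(ω)` by `windowfree_cert.py` of the seat's deposit.

HONEST FRAMING. Elementary linear algebra over a field; the Lean index of a bookkeeping lemma used
in a MODEL-LEVEL analysis of one SDR gauge of the cell's second code. No complex, sheaf or abelian
variety appears; nothing here says that HC, HC_CM or HC_AV holds, and nothing here is a new case of
anything.
-/

namespace Summit.Ventures.HSemireg

namespace WindowStability

open Submodule

universe u v

variable {K : Type u} [Field K] {V : Type v} [AddCommGroup V] [Module K V]

/-- LEMMA B (certificate form). Let `Bl ≤ Bn` («small» and «big» coboundaries) and `Cl` (the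
small window) be submodules, `η : ι → V` a finite family (the greedy representatives of the small
window) with `Bn ⊓ Cl ≤ Bl ⊔ span (range η)`, and `φ : σ → (V →ₗ[K] K)` functionals vanishing
on `Bn` whose pairing matrix with `η` has trivial left kernel. Then `Bn ⊓ Cl ≤ Bl`: the big
coboundary space meets the small window only in small coboundaries. -/
theorem inf_le_of_pairing {ι : Type*} [Fintype ι] {σ : Type*}
    (Bl Bn Cl : Submodule K V) (η : ι → V) (φ : σ → (V →ₗ[K] K))
    (hBB : Bl ≤ Bn)
    (hZ : Bn ⊓ Cl ≤ Bl ⊔ span K (Set.range η))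
    (hφ : ∀ s, ∀ v ∈ Bn, φ s v = 0)
    (hrank : ∀ c : ι → K, (∀ s, ∑ t, c t * φ s (η t) = 0) → c = 0) :
    Bn ⊓ Cl ≤ Bl := by
  intro v hv
  have hvZ : v ∈ Bl ⊔ span K (Set.range η) := hZ hv
  obtain ⟨b, hb, w, hw, hbw⟩ := mem_sup.mp hvZ
  obtain ⟨c, hc⟩ := (mem_span_range_iff_exists_fun K).mp hw
  -- every functional kills `v` (a big coboundary) and `b` (a small, hence big, coboundary)
  have hφw : ∀ s, φ s w = 0 := by
    intro s
    have h1 : φ s v = 0 := hφ s v (mem_inf.mp hv).1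
    have h2 : φ s b = 0 := hφ s b (hBB hb)
    have h3 : φ s v = φ s b + φ s w := by rw [← hbw, map_add]
    rw [h1, h2, zero_add] at h3
    exact h3.symm
  -- hence the coefficient vector of `w` is in the left kernel of the pairing matrix
  have hsum : ∀ s, ∑ t, c t * φ s (η t) = 0 := by
    intro s
    have h := hφw s
    rw [← hc, map_sum] at h
    simpa [map_smul, smul_eq_mul] using h
  have hc0 : c = 0 := hrank c hsum
  have hw0 : w = 0 := by
    rw [← hc]
    simp [hc0]
  rw [hw0, add_zero] at hbw
  rw [← hbw]
  exact hb

/-- LEMMA B in the form of hypothesis (N2) of the note: if moreover the small coboundaries lie in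
the small window (`Bl ≤ Cl`), then `Bn ⊓ Cl = Bl`. -/
theorem inf_eq_of_pairing {ι : Type*} [Fintype ι] {σ : Type*}
    (Bl Bn Cl : Submodule K V) (η : ι → V) (φ : σ → (V →ₗ[K] K))
    (hBB : Bl ≤ Bn) (hBC : Bl ≤ Cl)
    (hZ : Bn ⊓ Cl ≤ Bl ⊔ span K (Set.range η))
    (hφ : ∀ s, ∀ v ∈ Bn, φ s v = 0)
    (hrank : ∀ c : ι → K, (∀ s, ∑ t, c t * φ s (η t) = 0) → c = 0) :
    Bn ⊓ Cl = Bl :=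
  le_antisymm (inf_le_of_pairing Bl Bn Cl η φ hBB hZ hφ hrank) (le_inf hBB hBC)

/-- The degenerate case of LEMMA B: with NO representatives (`h = 0`, i.e. every small cycle is a
small coboundary: `Bn ⊓ Cl ≤ Bl` outright is the hypothesis `hZ` with an empty family) nothing is
to be checked. Recorded for the `(p, k = 2)` entry of the note's table. -/
theorem inf_le_of_no_reps (Bl Bn Cl : Submodule K V) (hZ : Bn ⊓ Cl ≤ Bl) : Bn ⊓ Cl ≤ Bl := hZ

/-- LEMMA A (A3), first half: a vector has at most one decomposition along three submodules
`Ks, B, H` that are independent in the sense `Ks ⊓ (B ⊔ H) = ⊥` and `B ⊓ H = ⊥` (on paper: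
`C_n = K_n ⊕ B_n ⊕ H_n`). Applied with the window-`ℓ` components, which lie in the window-`n`
submodules, it says that `p_n` and the `B`-component restrict to `p_ℓ` and the window-`ℓ`
`B`-component. -/
theorem decomposition_unique (Ks B H : Submodule K V)
    (hK : Ks ⊓ (B ⊔ H) = ⊥) (hBH : B ⊓ H = ⊥)
    {κ κ' b b' η η' : V} (hκ : κ ∈ Ks) (hκ' : κ' ∈ Ks) (hb : b ∈ B) (hb' : b' ∈ B)
    (hη : η ∈ H) (hη' : η' ∈ H) (hsum : κ + b + η = κ' + b' + η') :
    κ = κ' ∧ b = b' ∧ η = η' := by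
  -- the difference of the `K`-components lies in `Ks ⊓ (B ⊔ H) = ⊥`
  have hdk : κ - κ' ∈ Ks ⊓ (B ⊔ H) := by
    refine mem_inf.mpr ⟨Ks.sub_mem hκ hκ', ?_⟩
    have e : κ - κ' - ((b' - b) + (η' - η)) = (κ + b + η) - (κ' + b' + η') := by abel
    rw [hsum, sub_self] at e
    rw [sub_eq_zero.mp e]
    exact add_mem (mem_sup_left (B.sub_mem hb' hb)) (mem_sup_right (H.sub_mem hη' hη))
  rw [hK, mem_bot, sub_eq_zero] at hdk
  subst hdk
  -- then the difference of the `B`-components lies in `B ⊓ H = ⊥`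
  have hdb : b - b' ∈ B ⊓ H := by
    refine mem_inf.mpr ⟨B.sub_mem hb hb', ?_⟩
    have e : b - b' - (η' - η) = (κ + b + η) - (κ + b' + η') := by abel
    rw [hsum, sub_self] at e
    rw [sub_eq_zero.mp e]
    exact H.sub_mem hη' hη
  rw [hBH, mem_bot, sub_eq_zero] at hdb
  subst hdb
  refine ⟨rfl, rfl, ?_⟩
  have e : η - η' = (κ + b + η) - (κ + b + η') := by abel
  rw [hsum, sub_self] at e
  exact sub_eq_zero.mp e

/-- LEMMA A (A3), second half: a linear map that is injective on a submodule `Ks`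
(`ker d ⊓ Ks = ⊥`; on paper: `d` is injective on the greedy complement of the cycles) has at most
one `Ks`-preimage of a given value — so the homotopy `h = (d|_K)⁻¹` of the big window restricts to
the homotopy of the small window on small cochains, once `K_ℓ ≤ K_n`. -/
theorem preimage_unique {W : Type*} [AddCommGroup W] [Module K W]
    (d : V →ₗ[K] W) (Ks : Submodule K V) (hinj : LinearMap.ker d ⊓ Ks = ⊥)
    {κ κ' : V} (hκ : κ ∈ Ks) (hκ' : κ' ∈ Ks) (hd : d κ = d κ') : κ = κ' := by
  have hmem : κ - κ' ∈ LinearMap.ker d ⊓ Ks := by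
    refine mem_inf.mpr ⟨?_, Ks.sub_mem hκ hκ'⟩
    rw [LinearMap.mem_ker, map_sub, hd, sub_self]
  rw [hinj, mem_bot, sub_eq_zero] at hmem
  exact hmem

/-- The two halves together, in the shape used on paper: if the small window's pieces sit inside
the big window's (`Kl ≤ Kn`, `Bl ≤ Bn`, `Hl ≤ Hn`), the big pieces are independent, and a vector
decomposes along the small pieces, then any decomposition along the big pieces coincides with it. -/
theorem decomposition_restricts (Kl Kn Bl Bn Hl Hn : Submodule K V)
    (hKK : Kl ≤ Kn) (hBB : Bl ≤ Bn) (hHH : Hl ≤ Hn)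
    (hK : Kn ⊓ (Bn ⊔ Hn) = ⊥) (hBH : Bn ⊓ Hn = ⊥)
    {κ κ' b b' η η' : V} (hκ : κ ∈ Kl) (hb : b ∈ Bl) (hη : η ∈ Hl)
    (hκ' : κ' ∈ Kn) (hb' : b' ∈ Bn) (hη' : η' ∈ Hn) (hsum : κ + b + η = κ' + b' + η') :
    κ = κ' ∧ b = b' ∧ η = η' :=
  decomposition_unique Kn Bn Hn hK hBH (hKK hκ) hκ' (hBB hb) hb' (hHH hη) hη' hsum

/-! ### The level partition on the curve (THEOREM W (a), §1 of `WINDOW-EXACTNESS-w1cx2.md`)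

PROOF-ONLY: the level predicates are written out as hypotheses. `xⁱyʲ` (`0 ≤ i ≤ 2`) has window
level `≤ L` iff `2i + 3j ≤ 3L ∧ −j ≤ L` (`level (i, j) = max (⌈(2i+3j)∕3⌉, −j, 0)` in `surfB.py`);
«level exactly `L`» is «level `≤ L` and not level `≤ L − 1`». -/

/-- The monomials of level exactly `L ≥ 2` are the six listed in the note:
`y^{−L}, xy^{−L}, x²y^{−L}` (the «polar» triple) and `y^L, xy^{L−1}, x²y^{L−2}` (the «regular» triple). -/
theorem levelExact_iff {i j L : ℤ} (hi0 : 0 ≤ i) (hi2 : i ≤ 2) (hL : 2 ≤ L) :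
    ((2 * i + 3 * j ≤ 3 * L ∧ -j ≤ L) ∧ ¬ (2 * i + 3 * j ≤ 3 * (L - 1) ∧ -j ≤ L - 1)) ↔
      (j = -L ∨ (i = 0 ∧ j = L) ∨ (i = 1 ∧ j = L - 1) ∨ (i = 2 ∧ j = L - 2)) := by
  constructor
  · intro h; omega
  · intro h; omega

/-- THEOREM W (a), the heart: for `L ≥ 2` and `−2 ≤ a ≤ 3` every monomial of level exactly `L` lies
in EXACTLY ONE of `𝒪(U₀) = {j ≥ 0}` and `𝒪(a·o)(U₁) = {2i + 3j ≤ a}`; hence the level-`L` graded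
piece of `𝒪(U₀) ⊕ 𝒪(a·o)(U₁) → 𝒪(U₀ ∩ U₁)` (difference of restrictions; all six monomials live on
the right) is a bijection `K³ ⊕ K³ → K⁶` and the graded piece is acyclic. -/
theorem levelExact_partition {i j L a : ℤ} (hi0 : 0 ≤ i) (hi2 : i ≤ 2) (hL : 2 ≤ L)
    (ha1 : -2 ≤ a) (ha2 : a ≤ 3)
    (hle : 2 * i + 3 * j ≤ 3 * L ∧ -j ≤ L) (hgt : ¬ (2 * i + 3 * j ≤ 3 * (L - 1) ∧ -j ≤ L - 1)) :
    (0 ≤ j ∧ ¬ 2 * i + 3 * j ≤ a) ∨ (¬ 0 ≤ j ∧ 2 * i + 3 * j ≤ a) := by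
  omega

/-- The same from level `3` on for pole orders `|a| ≤ 4` (the alphabet of the cell's blocks). -/
theorem levelExact_partition' {i j L a : ℤ} (hi0 : 0 ≤ i) (hi2 : i ≤ 2) (hL : 3 ≤ L)
    (ha1 : -4 ≤ a) (ha2 : a ≤ 4)
    (hle : 2 * i + 3 * j ≤ 3 * L ∧ -j ≤ L) (hgt : ¬ (2 * i + 3 * j ≤ 3 * (L - 1) ∧ -j ≤ L - 1)) :
    (0 ≤ j ∧ ¬ 2 * i + 3 * j ≤ a) ∨ (¬ 0 ≤ j ∧ 2 * i + 3 * j ≤ a) := by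
  omega

/-- Exactly three of the six level-`L` monomials are regular away from `o` (`j ≥ 0`): the count
behind «`K³ ⊕ K³ → K⁶`» (with `levelExact_partition` the other three are the polar ones). Stated
as: a level-`L` monomial has `j ≥ 0` iff it is one of `y^L, xy^{L−1}, x²y^{L−2}` (`L ≥ 2`). -/
theorem levelExact_regular_iff {i j L : ℤ} (hi0 : 0 ≤ i) (hi2 : i ≤ 2) (hL : 2 ≤ L)
    (hle : 2 * i + 3 * j ≤ 3 * L ∧ -j ≤ L) (hgt : ¬ (2 * i + 3 * j ≤ 3 * (L - 1) ∧ -j ≤ L - 1)) :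
    0 ≤ j ↔ ((i = 0 ∧ j = L) ∨ (i = 1 ∧ j = L - 1) ∨ (i = 2 ∧ j = L - 2)) := by
  constructor
  · intro h; omega
  · intro h; omega

/-- Sharpness of the range: at `L = 2`, `a = 4` the monomial `x²` (`i = 2`, `j = 0`, level exactly
`2`) lies in BOTH `U₀` and `U₁` — the global section `x²` of `𝒪(4·o)`, genuine cohomology at
level `2` (so «from level 3 on» in `levelExact_partition'` cannot be lowered). -/
theorem levelExact_two_four_overlap :
    ((2 * (2 : ℤ) + 3 * 0 ≤ 3 * 2 ∧ -(0 : ℤ) ≤ 2) ∧ ¬ (2 * (2 : ℤ) + 3 * 0 ≤ 3 * (2 - 1) ∧ -(0 : ℤ) ≤ 2 - 1))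
      ∧ (0 : ℤ) ≤ 0 ∧ 2 * (2 : ℤ) + 3 * 0 ≤ 4 := by
  omega

end WindowStability

end Summit.Ventures.HSemireg
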